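import Mathlib
import Summits.NavierStokesRegularity.NavierStokesRegularity.Theorems.WakeRatchetTailRatchetDyadicScalarFramesWindow
import HarnessLib
import HarnessLib.Audit

/-!
# `WakeRatchet.TailRatchet` (stmt-NavierStokesRegularity-21808) — negative lemma modulo PERSISTENT SCALAR FRAMES
# of the renormalised dyadic lattice (door D4′ of the item's census, its analytic debt named as ONE construction)

The tree refutes the crux modulo EXACT scalar dyadic fronts (`WakeRatchetDyadicFront.DyadicScalarFronts`,
`TailRatchet_false_of_DyadicScalarFronts`; proved at every large base, open at small `ε₀`).  Door D4′ replaces the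
exact front by a COMPACTNESS argument: bounded frames of the renormalised dyadic lattice on growing half-lines with
three uniform estimates have an admissible, persistently firing eternal limit, which `TailRatchet` forbids
(`WakeRatchetDyadicScalarEternal.tailRatchet_false_of_scalarFramesWindow`, kernel-checked: Arzelà–Ascoli in the
shell-indexed scalar setting, passage of the lattice law / window mass / forward energy / windowed firing to the
continuous limit, the scalar ⇒ `IsEternal dyadicTable` adapter, and the stall kill criterion).  This file names the
input of that door as a single construction:

`DyadicPersistentFrames`: at arbitrarily small `ε₀`, scalar frames `V_j : ℤ → ℝ → ℝ` solving
`V' = −V + ΛV²₋ − Λ⁻¹VV₊` (`Λ = bigLam ε₀`) on half-lines `σ > A_j`, `A_j → −∞`, with a uniform bound, a uniform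
WINDOW-MASS bound, per-shell FORWARD ENERGY bounds, and FIRING of every forward shell `n₀ + k` inside a recentred
log-time window `[σ₀, σ₀ + g_k]`, eventually in `j`.

THE INTENDED INHABITANT (not constructed here): the frames of the one-shell non-negative dyadic Cauchy blow-up
(`WakeRatchetDyadicCauchy.dyadic_blowup`, finite blow-up time `T*` for every `Λ > 1`, exactly type-I
`dyadic_blowup_typeI`) recentred at the first firing log-times `s_j` of consecutive shells: they solve the
renormalised lattice and are uniformly bounded by `2Λ²/(Λ−1)²` on `σ > −s_j − log T*`
(`WakeRatchetDyadicCauchy.blowup_frames_bounded`); what is NOT proved is, uniformly as `ε₀ → 0`: (W) the window-mass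
bound (= the census's pre-firing quietness (Q) + post-firing wake decay (D)), (E) the forward energy bound (wake
energy above shell `j` ≲ its firing energy), (G) firing-gap bounds `s_{j+k} − s_j ≤ g_k` (front speed).  Exact scalar
fronts (`DyadicScalarFronts`) inhabit `DyadicPersistentFrames` trivially (constant frame sequence), so this
construction is WEAKER than the existing one.

HONEST FRAMING: MODEL lattice ODEs (Tao 2016 §1.2, §4, §6.4); nothing here concerns the Navier–Stokes equations;
nothing is settled unconditionally; the item stays open (negative lemma modulo a construction).
-/

noncomputable section

set_option linter.dupNamespace false

namespace Summit.NavierStokesRegularity.NavierStokesRegularity.Theorems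

namespace WakeRatchetDyadicScalarEternal

open Set Filter Topology MeasureTheory intervalIntegral
open Literature.Analysis.FluidPDE Literature.Analysis.FluidPDE.TaoCascade

/-- **The construction `TailRatchet` is refuted modulo (door D4′): PERSISTENT SCALAR FRAMES of the renormalised
dyadic lattice at arbitrarily small scale ratios.**  For every `ε > 0` there are `ε₀ ∈ (0, ε]` and scalar frames
`V_j : ℤ → ℝ → ℝ` (`j ∈ ℕ`) solving `V_n' = −V_n + Λ V_{n−1}² − Λ⁻¹ V_n V_{n+1}`, `Λ = bigLam ε₀`, on half-lines
`σ > A_j` with `A_j → −∞`, such that: `|V_j n σ| ≤ B` there; `∫_a^b |V_j n| ≤ M` for `A_j < a ≤ b` (window mass);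
for every shell `n` some `σ₁, P` with `e^{2σ} V_j n(σ)² ≤ P` for `σ ≥ σ₁`, `σ > A_j`, all `j` (forward energy); and
some level `c > 0`, base shell `n₀`, log-time `σ₀` and widths `g_k` such that for every `k`, eventually in `j`,
`|V_j (n₀+k) τ| ≥ c` for some `τ ∈ [σ₀, σ₀ + g_k]` (firing in windows).  Intended inhabitant: the frames of the
one-shell non-negative dyadic blow-up recentred at consecutive firing times (tree: `dyadic_blowup`,
`blowup_frames_bounded` give the law and the bound; window mass, forward energy and firing gaps are open).
[cite: Tao2016AveragedNS, §1.2 (dyadic model), §4 Lemma 4.1 (4.8), §6.4; cell vocabulary (construction item of door D4′ for stmt-21808)] -/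
@[conjecture] def DyadicPersistentFrames : Prop :=
  ∀ ε : ℝ, 0 < ε → ∃ ε₀ : ℝ, 0 < ε₀ ∧ ε₀ ≤ ε ∧
    ∃ (V : ℕ → ℤ → ℝ → ℝ) (A : ℕ → ℝ) (B M : ℝ),
      Tendsto A atTop atBot ∧
      (∀ (j : ℕ) (n : ℤ) (σ : ℝ), A j < σ → HasDerivAt (V j n)
        (-(V j n σ) + bigLam ε₀ * V j (n - 1) σ ^ 2 - (bigLam ε₀)⁻¹ * V j n σ * V j (n + 1) σ) σ) ∧
      (∀ (j : ℕ) (n : ℤ) (σ : ℝ), A j < σ → |V j n σ| ≤ B) ∧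
      (∀ (j : ℕ) (n : ℤ) (a b : ℝ), A j < a → a ≤ b → ∫ u in a..b, |V j n u| ≤ M) ∧
      (∀ n : ℤ, ∃ σ₁ P : ℝ, ∀ (j : ℕ) (σ : ℝ), σ₁ ≤ σ → A j < σ →
        Real.exp (2 * σ) * V j n σ ^ 2 ≤ P) ∧
      (∃ c : ℝ, 0 < c ∧ ∃ (n₀ : ℤ) (σ₀ : ℝ) (g : ℕ → ℝ), ∀ k : ℕ, ∀ᶠ j in atTop,
        ∃ τ : ℝ, σ₀ ≤ τ ∧ τ ≤ σ₀ + g k ∧ c ≤ |V j (n₀ + k) τ|)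

/-- **Negative lemma (door D4′): `DyadicPersistentFrames → ¬ TailRatchet`.**  Persistent scalar frames at
arbitrarily small scale ratios have, along a subsequence, an admissible uniformly bounded eternal limit of the
dyadic member `dyadicTable ∈ E₂(2)` with persistent firing, which `TailRatchet` stalls
(`tailRatchet_false_of_scalarFramesWindow`).
[cite: Tao2016AveragedNS, §1.2, §4 Lemma 4.1 (4.8), §6.4; cell vocabulary] -/
theorem TailRatchet_false_of_DyadicPersistentFrames :
    DyadicPersistentFrames →
      ¬ Summit.NavierStokesRegularity.NavierStokesRegularity.Theses.WakeRatchet.TailRatchet :=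
  fun h => tailRatchet_false_of_scalarFramesWindow h

end WakeRatchetDyadicScalarEternal

end Summit.NavierStokesRegularity.NavierStokesRegularity.Theorems

end
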